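import Summits.Parity.BatemanHorn.Theorems.BalancedSemiprimeLayer.Negative.TypeIBlindLayerBlocks
import Summits.Parity.BatemanHorn.Theses.RoughValueTransport

/-!
# `BalancedSemiprimeLayer` (crux stmt-Parity-9469): the crux's inequality is INVISIBLE to Type-I
# information of level below the balanced window — part 2, the crux-shaped statements

Sequel to `TypeIBlindLayerBlocks.lean` (lead seat c19, PROVED).  The crux asks, for every
Bateman–Horn system, that the values `fᵢ(n)`, `n ≤ x`, which are rough to depth `X^{(1−δ)/2}` of their
own size `X ≍ x^{deg fᵢ}` but NOT prime (the balanced-semiprime layer) number at most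
`εx/(log x)^k` beyond the prime values.  Here, at one height `x` and for integers `n ∈ (x/2, x]` in the
role of the values:

* `exists_typeI_primeFree_layerHeavy` — for `δ > 0`, `0 < γ < (1−δ)/2`, `B > 0` and all large `x`
  a bounded `a ≥ 0` whose `a − 1` satisfies (I) at level `x^γ` with exponent `B`, with NO mass on the
  primes of `(x/2, x]` and mass `≥ #primes(x/2, x] − x/(4 (log x)^B)` on the layer
  `{n ∈ (x/2, x] : no prime p < x^{(1−δ)/2} divides n, n not prime}` (verbatim the crux's
  rough-but-not-prime shape);
* `typeI_mono_exponent`; `eventually_card_primes_Ioc_half_ge` (`#primes(x/2, x] ≥ x/(4 log x)`, from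
  the tree's PROVED `|ϑ(y) − y| ≤ C y/log y`);
* `no_typeI_layer_bound` — **the headline**: for `δ > 0`, `0 < γ < (1−δ)/2`, `B > 0`, `ε < 1/4`
  there is NO `x₁` beyond which every bounded non-negative `a` whose `a − 1` has Type-I level `x^γ`
  (exponent `B`) satisfies `(layer mass of a at depth δ) ≤ (prime mass of a) + ε·x/log x`.
  The integers themselves satisfy this inequality once `δ ≤ δ(ε)` (the crux at the system `(X)`,
  PROVED: `Negative.TightAtX`), so the crux-shaped inequality is not a consequence of Type-I
  information of level below `x^{(1−δ)/2}`; for a coordinate of degree `d ≥ 3` (values of size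
  `X ≍ x^d`, `x` of them) every available divisibility datum has level `≤ x = X^{1/d} < X^{(1−δ)/2}`
  (`δ ≤ 1/4`) — the invariant deficit recorded for the open residual `LayerHigher`.  (The landed
  degree-`≤ 2` proof uses information NOT of the form (I): congruence roots to moduli beyond `x`.)

References: K. Ford, J. Maynard, arXiv:2407.14368 (2024), Theorem 4.16 (proof); crux dir
`Cruxes/BalancedSemiprimeLayer/{STRATEGY-CENSUS.md §1 (O1), Disproof.lean}`.  Everything used is
PROVED in the tree.
-/

noncomputable section

open Filter Finset Real
open Literature.Barriers.Parity.FordMaynard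

namespace Summit.Parity.BatemanHorn.Theorems.BalancedSemiprimeLayer.Negative

/-! ### The layer-heavy sequence in the crux's language -/

/-- **The layer-heavy, prime-free, Type-I-admissible sequence** (crux language).  For
`δ > 0`, `0 < γ < (1−δ)/2` (so `δ < 1`) and `B > 0` there are `C`, `x₀` such that for every `x ≥ x₀` some
`0 ≤ a ≤ C` has `a − 1` of Type-I level `x^γ` (exponent `B`), NO mass on the primes of `(x/2, x]`,
and mass at least `#primes(x/2, x] − x/(4 (log x)^B)` on the LAYER at height `x` and depth `δ`:
the `n ∈ (x/2, x]` all of whose prime factors exceed `x^{(1−δ)/2}` and which are not prime (for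
`δ < 1/3` exactly the balanced semiprimes `p q`, `x^{(1−δ)/2} < p ≤ q`).  From
`exists_typeI_primeFree_isPQHeavy` with the window `α₁ = (1−δ)/2 < α₂ = (1−δ/2)/2 < 1/2`: its
almost-primes lie in the layer. [folklore] -/
theorem exists_typeI_primeFree_layerHeavy {δ γ B : ℝ} (hδ0 : 0 < δ) (hγ0 : 0 < γ)
    (hγ : γ < (1 - δ) / 2) (hB : 0 < B) :
    ∃ C x₀ : ℝ, ∀ x : ℝ, x₀ ≤ x → ∃ a : ℕ → ℝ, (∀ n, 0 ≤ a n ∧ a n ≤ C) ∧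
      TypeI (fun n => a n - 1) x γ B ∧
      (∀ p : ℕ, p.Prime → x / 2 < (p : ℝ) → (p : ℝ) ≤ x → a p = 0) ∧
      ((((Ioc ⌊x / 2⌋₊ ⌊x⌋₊).filter Nat.Prime).card : ℝ) - x / Real.log x ^ B / 4 ≤
        ∑ n ∈ (Ioc ⌊x / 2⌋₊ ⌊x⌋₊).filter (fun n : ℕ =>
          (∀ p ∈ Finset.range ⌈x ^ ((1 - δ) / 2)⌉₊, p.Prime → ¬ (p ∣ n)) ∧ ¬ n.Prime), a n) := by
  have h12 : (1 - δ) / 2 < (1 - δ / 2) / 2 := by linarith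
  have h2 : (1 - δ / 2) / 2 < 1 / 2 := by linarith
  obtain ⟨C, x₀, hC⟩ := exists_typeI_primeFree_isPQHeavy hγ0 hγ h12 h2 hB
  refine ⟨C, max x₀ 1, fun x hx => ?_⟩
  have hx1 : 1 ≤ x := (le_max_right _ _).trans hx
  obtain ⟨a, ha, hI, hp, hlayer⟩ := hC x ((le_max_left _ _).trans hx)
  refine ⟨a, ha, hI, hp, hlayer.trans ?_⟩
  refine sum_le_sum_of_subset_of_nonneg (fun n hn => ?_) fun n _ _ => (ha n).1
  rw [mem_filter] at hn ⊢
  have hP₁ : 1 ≤ ⌊x ^ ((1 - δ) / 2)⌋₊ :=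
    Nat.le_floor (by rw [Nat.cast_one]; exact Real.one_le_rpow hx1 (by linarith))
  have hfl : x ^ ((1 - δ) / 2) < (⌊x ^ ((1 - δ) / 2)⌋₊ : ℝ) + 1 := Nat.lt_floor_add_one _
  have hmin : ⌊x ^ ((1 - δ) / 2)⌋₊ < n.minFac := hn.2.1
  refine ⟨hn.1, fun p hp hpp hpn => ?_, hn.2.not_prime⟩
  have hpy : (p : ℝ) < x ^ ((1 - δ) / 2) := Nat.lt_ceil.mp (mem_range.mp hp)
  rcases hn.2.eq_of_dvd hP₁ hpn with h | h | h | h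
  · exact absurd (h ▸ hpp) Nat.not_prime_one
  · have h' : ⌊x ^ ((1 - δ) / 2)⌋₊ + 1 ≤ p := by rw [h]; exact hmin
    have : x ^ ((1 - δ) / 2) < p :=
      calc x ^ ((1 - δ) / 2) < (⌊x ^ ((1 - δ) / 2)⌋₊ : ℝ) + 1 := hfl
        _ ≤ p := by exact_mod_cast h'
    linarith
  · have hle := hn.2.minFac_le_div
    have h' : ⌊x ^ ((1 - δ) / 2)⌋₊ + 1 ≤ p := by rw [h]; exact hmin.trans_le hle
    have : x ^ ((1 - δ) / 2) < p :=
      calc x ^ ((1 - δ) / 2) < (⌊x ^ ((1 - δ) / 2)⌋₊ : ℝ) + 1 := hfl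
        _ ≤ p := by exact_mod_cast h'
    linarith
  · exact absurd (h ▸ hpp) hn.2.not_prime

/-! ### The operational form: no Type-I proof of the layer inequality below the window -/

/-- Ford–Maynard's (I) is monotone in the exponent: (I) with exponent `B'` implies (I) with any
`B ≤ B'` once `log x ≥ 1` (`τ(m)^B ≤ τ(m)^{B'}` as `τ(m) ≥ 1`; `x/(log x)^{B'} ≤ x/(log x)^B`).
[folklore] -/
theorem typeI_mono_exponent {w : ℕ → ℝ} {x γ B B' : ℝ} (h : TypeI w x γ B') (hBB' : B ≤ B')
    (hx : 0 ≤ x) (hlx : 1 ≤ Real.log x) : TypeI w x γ B := by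
  intro I
  have h1 := h I
  have hτ : ∀ m ∈ Icc 1 ⌊x ^ γ⌋₊, (1 : ℝ) ≤ (m.divisors.card : ℝ) := by
    intro m hm
    rw [mem_Icc] at hm
    have : 0 < m.divisors.card := Finset.card_pos.mpr ⟨1, Nat.one_mem_divisors.mpr (by omega)⟩
    exact_mod_cast this
  calc ∑ m ∈ Icc 1 ⌊x ^ γ⌋₊, ((m.divisors.card : ℝ) ^ B) *
          |∑ n ∈ (Icc (I m).1 (I m).2).filter
              (fun n : ℕ => x / 2 < (m * n : ℝ) ∧ (m * n : ℝ) ≤ x), w (m * n)|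
      ≤ ∑ m ∈ Icc 1 ⌊x ^ γ⌋₊, ((m.divisors.card : ℝ) ^ B') *
          |∑ n ∈ (Icc (I m).1 (I m).2).filter
              (fun n : ℕ => x / 2 < (m * n : ℝ) ∧ (m * n : ℝ) ≤ x), w (m * n)| :=
        sum_le_sum fun m hm => mul_le_mul_of_nonneg_right
          (Real.rpow_le_rpow_of_exponent_le (hτ m hm) hBB') (abs_nonneg _)
    _ ≤ x / Real.log x ^ B' := h1
    _ ≤ x / Real.log x ^ B :=
        div_le_div_of_nonneg_left hx (Real.rpow_pos_of_pos (by linarith) B)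
          (Real.rpow_le_rpow_of_exponent_le hlx hBB')

open Literature.NumberTheory.LFunctions.Mertens in
/-- **Chebyshev lower bound for the primes of `(x/2, x]`**: eventually
`#primes(⌊x/2⌋, ⌊x⌋] ≥ x/(4 log x)` (from the tree's PROVED `|ϑ(y) − y| ≤ C y/log y` and
`ϑ(X) − ϑ(H) ≤ #primes(H, X]·log X`). [folklore] -/
theorem eventually_card_primes_Ioc_half_ge :
    ∀ᶠ x : ℝ in atTop, x / (4 * Real.log x) ≤ (((Ioc ⌊x / 2⌋₊ ⌊x⌋₊).filter Nat.Prime).card : ℝ) := by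
  obtain ⟨C, hC0, hC⟩ := exists_abs_theta_sub_le_div_log_pow 1
  have hlog4 : ∀ᶠ x : ℝ in atTop, 12 * C + 1 ≤ Real.log (x / 4) :=
    (tendsto_id.atTop_div_const (by norm_num : (0 : ℝ) < 4)).eventually
      (Real.tendsto_log_atTop.eventually_ge_atTop (12 * C + 1))
  filter_upwards [eventually_ge_atTop (16 : ℝ), hlog4] with x hx hlx4
  have hx0 : 0 < x := by linarith
  set H : ℕ := ⌊x / 2⌋₊ with hHdef
  set X : ℕ := ⌊x⌋₊ with hXdef
  have hXx : (X : ℝ) ≤ x := Nat.floor_le hx0.le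
  have hxX : x - 1 < X := by have := Nat.lt_floor_add_one x; rw [← hXdef] at this; linarith
  have hHx : (H : ℝ) ≤ x / 2 := Nat.floor_le (by positivity)
  have hxH : x / 2 - 1 < H := by have := Nat.lt_floor_add_one (x / 2); rw [← hHdef] at this; linarith
  have hHX : H ≤ X := Nat.floor_le_floor (by linarith)
  have hH4 : x / 4 ≤ H := by linarith
  have hH2 : (2 : ℝ) ≤ H := by linarith
  have hX2 : (2 : ℝ) ≤ X := by linarith
  have hlx4pos : 0 < Real.log (x / 4) := by linarith
  -- log H, log X ≥ log (x/4) ≥ 12 C + 1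
  have hlogH : Real.log (x / 4) ≤ Real.log H := Real.log_le_log (by positivity) hH4
  have hlogX : Real.log (x / 4) ≤ Real.log X := Real.log_le_log (by positivity) (by linarith)
  have hlogHpos : 0 < Real.log H := by linarith
  have hlogXpos : 0 < Real.log X := by linarith
  have hlogXle : Real.log X ≤ Real.log x := Real.log_le_log (by linarith) hXx
  have hlogxpos : 0 < Real.log x := by linarith
  -- the error terms `C y / log y ≤ x / 12` at `y = H, X`
  have hθX := hC X hX2
  have hθH := hC H hH2
  rw [pow_one] at hθX hθH
  have herrX : C * X / Real.log X ≤ x / 12 := by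
    rw [div_le_iff₀ hlogXpos]
    have h1 : C * (X : ℝ) ≤ C * x := mul_le_mul_of_nonneg_left hXx hC0
    have h2 : C * x ≤ x / 12 * Real.log X := by
      have : 12 * C ≤ Real.log X := by linarith
      nlinarith
    linarith
  have herrH : C * H / Real.log H ≤ x / 12 := by
    rw [div_le_iff₀ hlogHpos]
    have h1 : C * (H : ℝ) ≤ C * x := mul_le_mul_of_nonneg_left (by linarith) hC0
    have h2 : C * x ≤ x / 12 * Real.log H := by
      have : 12 * C ≤ Real.log H := by linarith
      nlinarith
    linarith
  have hbX := (abs_le.mp hθX).1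
  have hbH := (abs_le.mp hθH).2
  -- `ϑ(X) − ϑ(H) ≥ x/4`
  have hdiff : x / 4 ≤ Chebyshev.theta X - Chebyshev.theta H := by linarith
  have hcard := theta_sub_theta_le_card_primes_Ioc_mul_log hHX
  have hmain : x / 4 ≤ (((Ioc H X).filter Nat.Prime).card : ℝ) * Real.log x := by
    refine hdiff.trans (hcard.trans ?_)
    exact mul_le_mul_of_nonneg_left hlogXle (Nat.cast_nonneg _)
  rw [div_le_iff₀ (by positivity)]
  linarith

/-- **No Type-I proof of the layer inequality below the balanced window** (the headline).  Let
`δ > 0`, `0 < γ < (1−δ)/2`, `B > 0`, `ε < 1/4`.  There is NO `x₁` such that for all `x ≥ x₁`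
every bounded non-negative sequence `a` whose `a − 1` satisfies Ford–Maynard's Type-I bound (I) at
level `x^γ` with exponent `B` obeys
`∑_{n ∈ (x/2, x], n x^{(1−δ)/2}-rough, n not prime} a_n ≤ ∑_{p ∈ (x/2, x]} a_p + ε·x/log x`
— the shape of `BalancedSemiprimeLayer` ("rough-but-not-prime mass ≤ prime mass + ε x/log x",
values of size `≍ x`).  Witness: `exists_typeI_primeFree_layerHeavy` at exponent `max B 2` (prime
mass `0`, layer mass `≥ #primes(x/2, x] − x/(4 log² x) ≥ x/(4 log x) − x/(4 log² x)` by
`eventually_card_primes_Ioc_half_ge`), and `typeI_mono_exponent`.  Since the integers DO satisfy the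
inequality for `δ ≤ δ(ε)` (the crux at the system `(X)`, `Negative.TightAtX`), the crux-shaped
inequality is not a consequence of Type-I information of level below `x^{(1−δ)/2}`; for a coordinate
of degree `d ≥ 3` every available divisibility datum on the values (size `X ≍ x^d`) has level
`≤ x = X^{1/d} < X^{(1−δ)/2}` — obstruction O1 of the crux census, now a kernel fact. [folklore] -/
theorem no_typeI_layer_bound {δ γ B ε : ℝ} (hδ0 : 0 < δ) (hγ0 : 0 < γ)
    (hγ : γ < (1 - δ) / 2) (hB : 0 < B) (hε : ε < 1 / 4) :
    ¬ ∃ x₁ : ℝ, ∀ x : ℝ, x₁ ≤ x → ∀ a : ℕ → ℝ, (∃ C : ℝ, ∀ n, 0 ≤ a n ∧ a n ≤ C) →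
        TypeI (fun n => a n - 1) x γ B →
          ∑ n ∈ (Ioc ⌊x / 2⌋₊ ⌊x⌋₊).filter (fun n : ℕ =>
              (∀ p ∈ Finset.range ⌈x ^ ((1 - δ) / 2)⌉₊, p.Prime → ¬ (p ∣ n)) ∧ ¬ n.Prime), a n ≤
            ∑ p ∈ (Ioc ⌊x / 2⌋₊ ⌊x⌋₊).filter Nat.Prime, a p + ε * x / Real.log x := by
  rintro ⟨x₁, hbound⟩
  have hB' : 0 < max B 2 := lt_max_of_lt_left hB
  obtain ⟨C, x₀, hC⟩ := exists_typeI_primeFree_layerHeavy hδ0 hγ0 hγ hB'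
  have hε4 : 0 < 1 - 4 * ε := by linarith
  obtain ⟨x, hx⟩ := Filter.eventually_atTop.mp (eventually_card_primes_Ioc_half_ge.and
    ((eventually_ge_atTop (max x₀ x₁)).and ((eventually_ge_atTop (16 : ℝ)).and
      (Real.tendsto_log_atTop.eventually_ge_atTop (2 / (1 - 4 * ε) + 2)))))
  obtain ⟨hprimes, hx01, hx16, hlogx⟩ := hx x le_rfl
  have hx0 : 0 < x := by linarith
  have hxx₀ : x₀ ≤ x := (le_max_left _ _).trans hx01
  have hxx₁ : x₁ ≤ x := (le_max_right _ _).trans hx01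
  have h2ε : (0 : ℝ) < 2 / (1 - 4 * ε) := by positivity
  have hlx1 : 1 ≤ Real.log x := by linarith
  have hlx0 : 0 < Real.log x := by linarith
  obtain ⟨a, ha, hI', hp, hlayer⟩ := hC x hxx₀
  have hI : TypeI (fun n => a n - 1) x γ B := typeI_mono_exponent hI' (le_max_left _ _) hx0.le hlx1
  have hb := hbound x hxx₁ a ⟨C, ha⟩ hI
  -- the prime mass of `a` vanishes
  have hprime0 : ∑ p ∈ (Ioc ⌊x / 2⌋₊ ⌊x⌋₊).filter Nat.Prime, a p = 0 := by
    refine sum_eq_zero fun p hpm => ?_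
    rw [mem_filter, mem_Ioc] at hpm
    refine hp p hpm.2 ?_ ?_
    · have h1 : x / 2 < (⌊x / 2⌋₊ : ℝ) + 1 := Nat.lt_floor_add_one _
      have h2 : ⌊x / 2⌋₊ + 1 ≤ p := hpm.1.1
      calc x / 2 < (⌊x / 2⌋₊ : ℝ) + 1 := h1
        _ ≤ p := by exact_mod_cast h2
    · exact (Nat.cast_le.mpr hpm.1.2).trans (Nat.floor_le hx0.le)
  rw [hprime0, zero_add] at hb
  -- the layer mass of `a` is at least `x/(4 log x) − x/(4 log² x)`
  have hpow : Real.log x ^ (2 : ℝ) ≤ Real.log x ^ (max B 2) :=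
    Real.rpow_le_rpow_of_exponent_le hlx1 (le_max_right _ _)
  have herr : x / Real.log x ^ (max B 2) / 4 ≤ x / Real.log x ^ (2 : ℝ) / 4 :=
    div_le_div_of_nonneg_right
      (div_le_div_of_nonneg_left hx0.le (Real.rpow_pos_of_pos hlx0 _) hpow) (by norm_num)
  have hsq : Real.log x ^ (2 : ℝ) = Real.log x * Real.log x := by
    rw [show (2 : ℝ) = (2 : ℕ) by norm_num, Real.rpow_natCast, pow_two]
  rw [hsq] at herr
  have hchain : x / (4 * Real.log x) - x / (Real.log x * Real.log x) / 4 ≤ ε * x / Real.log x := by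
    linarith
  -- multiply through by `4 log x / x`
  have h1 : x / (4 * Real.log x) - x / (Real.log x * Real.log x) / 4 =
      x / (4 * Real.log x) * (1 - 1 / Real.log x) := by
    field_simp
  have h2 : ε * x / Real.log x = x / (4 * Real.log x) * (4 * ε) := by
    field_simp
  rw [h1, h2] at hchain
  have hpos : 0 < x / (4 * Real.log x) := by positivity
  have h3 : 1 - 1 / Real.log x ≤ 4 * ε := le_of_mul_le_mul_left hchain hpos
  have h4 : 1 - 4 * ε ≤ 1 / Real.log x := by linarith
  rw [le_div_iff₀ hlx0] at h4
  have h5 : (1 - 4 * ε) * (2 / (1 - 4 * ε) + 2) ≤ (1 - 4 * ε) * Real.log x :=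
    mul_le_mul_of_nonneg_left hlogx hε4.le
  have h6 : (1 - 4 * ε) * (2 / (1 - 4 * ε) + 2) = 2 + 2 * (1 - 4 * ε) := by
    field_simp
  rw [h6] at h5
  nlinarith

end Summit.Parity.BatemanHorn.Theorems.BalancedSemiprimeLayer.Negative
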